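import Literature.AlgebraicGeometry.Resolution.BlowupAlgebraPresentation
import Mathlib.RingTheory.RegularLocalRing.Polynomial
import HarnessLib

/-!
# The elimination chart of the blow-up of the `A₂` surface `yz + x³ = 0` at the origin is a
polynomial ring (crux `FrobeniusLadder.FRationalResolution`, line `Sketch`)

Stub `stub_chart_elim_cube` (worker U4) of the skeleton `Sketch` for crux
stmt-ResolutionOfSingularities-15317 (continuation seat c2, wave 2: the lead resolves the first
singular hyperbolic suspensions by one blowing up of the origin; this is the `x`-chart of
`Bl_{(x,y,z)} {yz + x³ = 0}`).

Let `k` be a field and `R` a `k`-algebra generated by `x, y, z` with `yz + x³ = 0`, admitting the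
TEST MAP `θ : R → k[Y', Z'][1/(Y'Z')]`, `θ x = −Y'Z'`, `θ y = −Y'²Z'`, `θ z = −Y'Z'²`. Let
`B = R[I/x] ⊆ R[1/x]` be the affine blowup algebra of `I = (x, y, z)` at `x` (image model,
`blowupAlgebra`, `AffineBlowupAlgebra.lean`). Then `B` is a regular ring; indeed
`k[Y', Z'] → B`, `Y' ↦ u = y/x`, `Z' ↦ v = z/x` is an isomorphism:

* in `R[1/x]`: `x² · uv = yz = −x³` and `x` is a unit, so `uv = −x`; with `y = u·x`, `z = v·x`
  the structure map `R → R[1/x]` lands in the subring generated by `u, v` (as `R = k[x, y, z]`,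
  `hgen`), and so does every generator `r/x = a + b u + c v` (`r = a x + b y + c z ∈ I`) of `B`:
  SURJECTIVE;
* `θ x = −Y'Z'` is a unit of `L = k[Y', Z'][1/(Y'Z')]`, so `θ` extends to `θ' : R[1/x] → L`
  (`IsLocalization.Away.lift`) with `θ'(u) · θ x = θ y`, whence `θ'(u) = Y'`, `θ'(v) = Z'`; the
  composite `k[Y', Z'] → B ⊆ R[1/x] → L` is the (injective) localization map: INJECTIVE.

Regularity of `k[Y', Z']` is Mathlib's instance `MvPolynomial.isRegularRing_of_isRegularRing`;
transport along the isomorphism by `IsRegularRing.of_ringEquiv`.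

References: The Stacks Project, Tag 052Q (affine blowup algebras); U. Görtz, T. Wedhorn,
*Algebraic Geometry I*, 2nd ed. (2020), (13.19) p. 415 (`A[I/f] ⊆ A_f`); the chart computation is
folklore (e.g. the `A_n` surface singularities are resolved by `⌈n/2⌉` point blow-ups).
-/

-- single-problem summit: the doubled namespace component is forced
set_option linter.dupNamespace false

namespace Summit.ResolutionOfSingularities.ResolutionOfSingularities.Theorems.FRationalResolution

open Literature.AlgebraicGeometry.Resolution

/-- **The key relation on the `x`-chart**: in `R[1/x]`, if `yz + x³ = 0` then
`(y/x) · (z/x) = −x`. [folklore] -/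
theorem div_mul_div_eq_neg_of_cube {R : Type*} [CommRing R] {x y z : R} (hrel : y * z + x ^ 3 = 0) :
    algebraMap R (Localization.Away x) y * IsLocalization.Away.invSelf x *
        (algebraMap R (Localization.Away x) z * IsLocalization.Away.invSelf x) =
      -(algebraMap R (Localization.Away x) x) := by
  have h1 := congrArg (algebraMap R (Localization.Away x)) hrel
  rw [map_add, map_mul, map_pow, map_zero] at h1
  have h2 := IsLocalization.Away.mul_invSelf (S := Localization.Away x) x
  linear_combination (IsLocalization.Away.invSelf x) ^ 2 * h1 +
    (-(algebraMap R (Localization.Away x) x) *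
      (1 + algebraMap R (Localization.Away x) x * IsLocalization.Away.invSelf x)) * h2

/-- **A generator `r/x`, `r = a x + b y + c z ∈ (x, y, z)`, of `R[I/x]` is `a + b (y/x) + c (z/x)`.**
[folklore] -/
theorem div_eq_of_mem_span_triple {R : Type*} [CommRing R] {x y z r : R}
    (hr : r ∈ Ideal.span ({x, y, z} : Set R)) :
    ∃ a b c : R, algebraMap R (Localization.Away x) r * IsLocalization.Away.invSelf x =
      algebraMap R (Localization.Away x) a +
        algebraMap R (Localization.Away x) b *
          (algebraMap R (Localization.Away x) y * IsLocalization.Away.invSelf x) +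
        algebraMap R (Localization.Away x) c *
          (algebraMap R (Localization.Away x) z * IsLocalization.Away.invSelf x) := by
  rw [Ideal.mem_span_insert] at hr
  obtain ⟨a, r', hr', rfl⟩ := hr
  rw [Ideal.mem_span_pair] at hr'
  obtain ⟨b, c, rfl⟩ := hr'
  refine ⟨a, b, c, ?_⟩
  have h2 := IsLocalization.Away.mul_invSelf (S := Localization.Away x) x
  simp only [map_add, map_mul]
  linear_combination (algebraMap R (Localization.Away x) a) * h2

/-- **Registered stub `stub_chart_elim_cube` — ELIMINATION CHART OF THE `A₂` SURFACE
`yz + x³ = 0` at `x`.** For a `k`-algebra `R` generated by `x, y, z` with `yz + x³ = 0` and a test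
map `θ : R → k[Y', Z'][1/(Y'Z')]`, `θ x = −Y'Z'`, `θ y = −Y'²Z'`, `θ z = −Y'Z'²`, the affine blowup
algebra `R[I/x]`, `I = (x, y, z)`, is a regular ring: `k[Y', Z'] ≅ R[I/x]` via `Y' ↦ y/x`,
`Z' ↦ z/x` (surjective by `uv = −x`, `y = u x`, `z = v x` and `hgen`; injective through the
extension of `θ` to `R[1/x]`, under which the composite is the localization map).
[folklore] -/
theorem stub_chart_elim_cube (k R : Type) [Field k] [CommRing R] [Algebra k R] (x y z : R)
    (hrel : y * z + x ^ 3 = 0) (hgen : Algebra.adjoin k {x, y, z} = ⊤)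
    (θ : R →ₐ[k] Localization.Away (MvPolynomial.X 0 * MvPolynomial.X 1 : MvPolynomial (Fin 2) k))
    (hθx : θ x = -(algebraMap (MvPolynomial (Fin 2) k) _ (MvPolynomial.X 0 * MvPolynomial.X 1)))
    (hθy : θ y = -(algebraMap (MvPolynomial (Fin 2) k) _ (MvPolynomial.X 0 ^ 2 * MvPolynomial.X 1)))
    (hθz : θ z = -(algebraMap (MvPolynomial (Fin 2) k) _ (MvPolynomial.X 0 * MvPolynomial.X 1 ^ 2))) :
    IsRegularRing (blowupAlgebra (Ideal.span {x, y, z}) x) := by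
  -- the fractions `u = y/x`, `v = z/x ∈ B = R[I/x]`
  have hyI : y ∈ Ideal.span ({x, y, z} : Set R) := Ideal.subset_span (by simp)
  have hzI : z ∈ Ideal.span ({x, y, z} : Set R) := Ideal.subset_span (by simp)
  have huB := div_mem_blowupAlgebra (Ideal.span ({x, y, z} : Set R)) x hyI
  have hvB := div_mem_blowupAlgebra (Ideal.span ({x, y, z} : Set R)) x hzI
  have huv := div_mul_div_eq_neg_of_cube hrel
  -- (2) the parametrisation `ψ : k[Y', Z'] → B` and its composite `φ` with `B ⊆ R[1/x]`
  let ψ : MvPolynomial (Fin 2) k →+* blowupAlgebra (Ideal.span ({x, y, z} : Set R)) x :=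
    MvPolynomial.eval₂Hom ((algebraMap R _).comp (algebraMap k R)) ![⟨_, huB⟩, ⟨_, hvB⟩]
  let φ : MvPolynomial (Fin 2) k →+* Localization.Away x :=
    (blowupAlgebra (Ideal.span ({x, y, z} : Set R)) x).val.toRingHom.comp ψ
  have hφψ : ∀ p, φ p = (ψ p : Localization.Away x) := fun p => rfl
  have hφ0 : φ (MvPolynomial.X 0) =
      algebraMap R (Localization.Away x) y * IsLocalization.Away.invSelf x := by
    simp [φ, ψ]
  have hφ1 : φ (MvPolynomial.X 1) =
      algebraMap R (Localization.Away x) z * IsLocalization.Away.invSelf x := by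
    simp [φ, ψ]
  have hφC : ∀ c, φ (MvPolynomial.C c) = algebraMap R (Localization.Away x) (algebraMap k R c) := by
    intro c
    simp [φ, ψ]
  -- (3) SURJECTIVE: the range of `φ` contains `x = -uv`, `y = u x`, `z = v x`, hence `R`, hence `B`
  have hur : algebraMap R (Localization.Away x) y * IsLocalization.Away.invSelf x ∈ φ.range :=
    RingHom.mem_range.mpr ⟨_, hφ0⟩
  have hvr : algebraMap R (Localization.Away x) z * IsLocalization.Away.invSelf x ∈ φ.range :=
    RingHom.mem_range.mpr ⟨_, hφ1⟩
  have hxr : algebraMap R (Localization.Away x) x ∈ φ.range := by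
    rw [show algebraMap R (Localization.Away x) x = -(algebraMap R (Localization.Away x) y *
        IsLocalization.Away.invSelf x * (algebraMap R (Localization.Away x) z *
        IsLocalization.Away.invSelf x)) by rw [huv, neg_neg]]
    exact neg_mem (mul_mem hur hvr)
  have hyr : algebraMap R (Localization.Away x) y ∈ φ.range := by
    rw [← div_mul_algebraMap x y]
    exact mul_mem hur hxr
  have hzr : algebraMap R (Localization.Away x) z ∈ φ.range := by
    rw [← div_mul_algebraMap x z]
    exact mul_mem hvr hxr
  have hR : ∀ r : R, algebraMap R (Localization.Away x) r ∈ φ.range := by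
    intro r
    have hr : r ∈ Algebra.adjoin k ({x, y, z} : Set R) := by rw [hgen]; exact Algebra.mem_top
    induction hr using Algebra.adjoin_induction with
    | mem r hr =>
      simp only [Set.mem_insert_iff, Set.mem_singleton_iff] at hr
      rcases hr with rfl | rfl | rfl
      · exact hxr
      · exact hyr
      · exact hzr
    | algebraMap c => exact RingHom.mem_range.mpr ⟨_, hφC c⟩
    | add r s _ _ hr hs => rw [map_add]; exact add_mem hr hs
    | mul r s _ _ hr hs => rw [map_mul]; exact mul_mem hr hs
  have hB : ∀ l ∈ blowupAlgebra (Ideal.span ({x, y, z} : Set R)) x, l ∈ φ.range := by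
    intro l hl
    induction hl using Algebra.adjoin_induction with
    | mem l hl =>
      obtain ⟨r, hr, rfl⟩ := hl
      obtain ⟨a, b, c, h⟩ := div_eq_of_mem_span_triple hr
      rw [h]
      exact add_mem (add_mem (hR a) (mul_mem (hR b) hur)) (mul_mem (hR c) hvr)
    | algebraMap r => exact hR r
    | add _ _ _ _ h h' => exact add_mem h h'
    | mul _ _ _ _ h h' => exact mul_mem h h'
  have hsurj : Function.Surjective ψ := by
    intro b
    obtain ⟨p, hp⟩ := RingHom.mem_range.mp (hB b.1 b.2)
    exact ⟨p, Subtype.ext (by rw [← hφψ, hp])⟩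
  -- (4) INJECTIVE: extend `θ` to `θ' : R[1/x] → L`; then `θ' ∘ φ` is the localization map
  have hunit : IsUnit (θ.toRingHom x) := by
    rw [AlgHom.toRingHom_eq_coe, RingHom.coe_coe, hθx]
    exact (IsLocalization.Away.algebraMap_isUnit _).neg
  have hunit' : IsUnit (θ x) := hunit
  have hlift : ∀ r, IsLocalization.Away.lift x hunit (algebraMap R (Localization.Away x) r) = θ r :=
    fun r => IsLocalization.Away.lift_eq x hunit r
  have hθ'u : IsLocalization.Away.lift x hunit (algebraMap R (Localization.Away x) y *
      IsLocalization.Away.invSelf x) = algebraMap (MvPolynomial (Fin 2) k) _ (MvPolynomial.X 0) := by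
    rw [← hunit'.mul_left_inj, ← hlift x, ← map_mul, div_mul_algebraMap, hlift, hlift, hθy, hθx]
    simp only [map_mul, map_pow]
    ring
  have hθ'v : IsLocalization.Away.lift x hunit (algebraMap R (Localization.Away x) z *
      IsLocalization.Away.invSelf x) = algebraMap (MvPolynomial (Fin 2) k) _ (MvPolynomial.X 1) := by
    rw [← hunit'.mul_left_inj, ← hlift x, ← map_mul, div_mul_algebraMap, hlift, hlift, hθz, hθx]
    simp only [map_mul, map_pow]
    ring
  have hcomp : (IsLocalization.Away.lift x hunit).comp φ =
      algebraMap (MvPolynomial (Fin 2) k) (Localization.Away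
        (MvPolynomial.X 0 * MvPolynomial.X 1 : MvPolynomial (Fin 2) k)) := by
    refine MvPolynomial.ringHom_ext (fun c => ?_) (Fin.forall_fin_two.mpr ⟨?_, ?_⟩)
    · rw [RingHom.comp_apply, hφC, hlift, AlgHom.commutes,
        IsScalarTower.algebraMap_apply k (MvPolynomial (Fin 2) k), MvPolynomial.algebraMap_eq]
    · rw [RingHom.comp_apply, hφ0, hθ'u]
    · rw [RingHom.comp_apply, hφ1, hθ'v]
  have hinj : Function.Injective ψ := by
    intro p q hpq
    have hne : (MvPolynomial.X 0 * MvPolynomial.X 1 : MvPolynomial (Fin 2) k) ≠ 0 :=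
      mul_ne_zero (MvPolynomial.X_ne_zero 0) (MvPolynomial.X_ne_zero 1)
    have key := RingHom.congr_fun hcomp
    apply IsLocalization.injective (M := Submonoid.powers
      (MvPolynomial.X 0 * MvPolynomial.X 1 : MvPolynomial (Fin 2) k)) (Localization.Away
      (MvPolynomial.X 0 * MvPolynomial.X 1 : MvPolynomial (Fin 2) k))
      (powers_le_nonZeroDivisors_of_noZeroDivisors hne)
    rw [← key, ← key]
    change IsLocalization.Away.lift x hunit (ψ p : Localization.Away x) =
      IsLocalization.Away.lift x hunit (ψ q : Localization.Away x)
    rw [hpq]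
  -- (5) transport regularity of `k[Y', Z']` along `ψ`
  exact IsRegularRing.of_ringEquiv (R := MvPolynomial (Fin 2) k) (RingEquiv.ofBijective ψ ⟨hinj, hsurj⟩)

end Summit.ResolutionOfSingularities.ResolutionOfSingularities.Theorems.FRationalResolution
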